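import Summits.Ventures.CertifiedArithmetic.LowPrec.GemmThetaLawGenE3M2Data

/-!
# E3M2×E3M2 law check, part 1/11: `Q` (sign +), `Q` (sign −), `bin 0` (sign +)

HONEST FRAMING (venture CertifiedArithmetic / cell `pub-lowprec`, seat gemm, gen 13): certified
error envelopes and provably optimal rounding/accumulation schemes for low-precision formats under
stated cost models; every table by two implementations; no hardware or vendor claims.

Part 1/11 of the per-level kernel check of `e3m2Law.lawCheck` (see
`GemmThetaLawGenE3M2Data.lean`): `Q` (sign +), `Q` (sign −), `bin 0` (sign +) (1445 + 1445 + 1434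
classes; a level above 2400 classes is split by sign, the two halves are joined in
`GemmThetaLawGenE3M2.lean`). [cell]
-/

namespace Literature.ComputerArithmetic.FloatingPoint

namespace MiniFloat

namespace ThetaLaw

/-- Level `Q`, sign `+`, of the E3M2×E3M2 law check: all classes pass and cover (1445 of the
level's 2890 classes, all 291 letters). [cell, kernel `decide`] -/
theorem levCheck_e3m2_Q_pos :
    (e3m2Law.lam.all fun q =>
      (e3m2Law.mainClasses Lev.Q 1 q).all e3m2Law.clsOK &&
        e3m2Law.coverOK Lev.Q 1 q) = true := by
  decide +kernel

/-- Level `Q`, sign `−`, of the E3M2×E3M2 law check: all classes pass and cover (1445 of the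
level's 2890 classes, all 291 letters). [cell, kernel `decide`] -/
theorem levCheck_e3m2_Q_neg :
    (e3m2Law.lam.all fun q =>
      (e3m2Law.mainClasses Lev.Q (-1) q).all e3m2Law.clsOK &&
        e3m2Law.coverOK Lev.Q (-1) q) = true := by
  decide +kernel

/-- Level `bin 0`, sign `+`, of the E3M2×E3M2 law check: all classes pass and cover (1434 of the
level's 2868 classes, all 291 letters). [cell, kernel `decide`] -/
theorem levCheck_e3m2_b0_pos :
    (e3m2Law.lam.all fun q =>
      (e3m2Law.mainClasses (Lev.bin 0) 1 q).all e3m2Law.clsOK &&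
        e3m2Law.coverOK (Lev.bin 0) 1 q) = true := by
  decide +kernel

end ThetaLaw

end MiniFloat

end Literature.ComputerArithmetic.FloatingPoint
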